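import Summits.BirchSwinnertonDyer.BirchSwinnertonDyer.Theorems.ClassRecordThreeEulerHalvesAtThreeSavingBookkeeping
import HarnessLib

/-!
# Crux `EulerHalvesAtThree` (item stmt-BirchSwinnertonDyer-19109; routes `ClassRecordThree` ∕ `KolyvaginRoadThree`):
# the JSW §7.4.2 Tamagawa bookkeeping with ONE saved place AND A BUDGETED EXTRA SET of bad places — the valuation half
# of EVERY «extra road» on the residue (cell `bsd-stepL`, seat `bsd-stepL-tam3-p1` g19, LINE OWNER of 19109;
# `--supports stmt-BirchSwinnertonDyer-19109 --as helper`)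

HONEST FRAMING: ONE THEOREM (no definition, no named fact, no `sorry`); pure valuation bookkeeping, CONDITIONAL on every
displayed binder; nothing here is a statement about CM points, Selmer groups or any particular curve; no census label moves (T7);
item 19109 is NOT closed by this file. BSD is proved for no curve.

WHY. The r16–r22 residue of line `inert` (`Theorems.EulerHalvesAtThreeCoStepLResidual`: multi-carrier curves with a NON-SPLIT `3`-carrier)
can only shrink by a further road that PAYS some bad places `C` outside the inert set `S` by a device other than Ribet–Takahashi (on `S`) or
Jetchev's one saving (at `q₁`): bsd-idea-10's non-split CARTAN places (`K` inert at an additive IV∕IV* carrier `q`, one place `w`,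
`ord₃ c_w(E∕K) = ord₃ c_q(E) + ord₃ c_q(E^{d_K}) = 1 + 0`, repaid by the Cartan degree law), tam3-p1 g17's ramified-carrier frames (one place,
`c_w ∈ {1, 3}`), … . Their common bookkeeping step is tam3-p1 g11's `padicValNat_tamagawaProduct_add_twist_le_of_inertSet'_binder_of_extraPlace`
(p-file `…SavingBookkeeping`, one exempted place `q₁`) with a SECOND exemption: a finite set `C` of bad primes, each exempted from the Tamagawa
SHAPE, the très-ramifié and the `K`-splitting binders, and each charged an ABSTRACT BUDGET `b q ≥ ord_p c_q(E) + ord_p c_q(E^{d_K})` (the road's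
local input: (F5)-type Tate-algorithm facts for Cartan places, `b = 1`). CONCLUSION: `ord_p ∏c(E) + ord_p ∏c(E^{d_K}) ≤ Σ_{ℓ∈S} ord_p(ord_ℓ Δ_min)
+ Σ_{q∈C} b q + 2·ord_p c_{q₁}(E)` — the `hT` input of `missingUpperBoundAt_of_shimuraShapes_of_saving` with `T := Σ_S + Σ_C b`. With `C = ∅`
it is the one-place theorem verbatim. Road-agnostic companion of `…ExtraRoadCutComposition` (p658732) and of the Defs
`Three.ExtraRoadAtThree Φ` ∕ `Three.CartanServableAtThree`.

References: [JetchevSkinnerWan2017] §7.4.2 (p. 31), §7.3.1 (eq:tamK); [Jetchev2008] Thm. 1.1, (1); [KohenPacetti2016] Thm. 3.6 (the Cartan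
instance of `C`); [SilvermanAEC2009] VII.6 Ex. 7.6; [SilvermanATAEC1994] IV.9.4; tree `…SavingBookkeeping.lean` (p-file of tam3-p1 g11).
-/

noncomputable section

open scoped Classical

open WeierstrassCurve NumberField IsDedekindDomain IsDedekindDomain.HeightOneSpectrum
  Literature.NumberTheory.EllipticCurves Rat.HeightOneSpectrum
  Literature.NumberTheory.EllipticCurves.ModularForms
  Literature.NumberTheory.EllipticCurves.Rank1Residual
  Literature.NumberTheory.EllipticCurves.Rank1Residual.Typed
  Literature.NumberTheory.DiophantineGeometry
  Summit.BirchSwinnertonDyer.Rank1Residual Summit.BirchSwinnertonDyer.Rank1Residual.X11b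

-- the cell's Theorems namespace repeats the summit name (Summit.<Summit>.<Problem>), as in every sibling file
set_option linter.dupNamespace false

namespace Summit.BirchSwinnertonDyer.BirchSwinnertonDyer.Theorems

/-- `ord_p` of a finite product of non-zero naturals is the sum of the `ord_p`. [folklore] -/
private theorem padicValNat_finset_prod_extraSet (p : ℕ) [Fact p.Prime] {ι : Type*} (s : Finset ι)
    (f : ι → ℕ) (hf : ∀ i ∈ s, f i ≠ 0) :
    padicValNat p (∏ i ∈ s, f i) = ∑ i ∈ s, padicValNat p (f i) := by
  induction s using Finset.induction_on with
  | empty => simp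
  | insert a s ha ih =>
    rw [Finset.prod_insert ha, Finset.sum_insert ha,
      padicValNat.mul (hf a (Finset.mem_insert_self a s))
        (Finset.prod_ne_zero_iff.mpr fun i hi => hf i (Finset.mem_insert_of_mem hi)),
      ih fun i hi => hf i (Finset.mem_insert_of_mem hi)]

/-- **The numeric Tamagawa condition of JSW §7.4.2 at every ODD `p`, ANY `d_K`, modulo the binder at `2`, with ONE SAVED PLACE `q₁ ∉ S`
AND A BUDGETED EXTRA SET `C` of bad primes.** As tam3-p1 g11's `padicValNat_tamagawaProduct_add_twist_le_of_inertSet'_binder_of_extraPlace`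
(`S` a set of multiplicative primes inert in `K`; ONE bad prime `q₁ ∉ S` exempted from the Tamagawa SHAPE and the très-ramifié binder and charged
`2·ord_p c_{q₁}(E)` — at `q₁` the twist has the same local Tamagawa number when `q₁` splits in `K`), except that a further finite set `C` of
primes (intended: bsd-idea-10's CARTAN places — additive IV∕IV* `3`-carriers with `K` INERT at them —, or any other places a road pays by its
own device) is ALSO exempted from the SHAPE, très-ramifié and `K`-SPLITTING binders, each `q ∈ C` being charged an abstract budget `b q` with
`ord_p c_q(E) + ord_p c_q(Wd) ≤ b q` (hypothesis `hC`; for a Cartan place `b q = 1` by Tate's algorithm: `c_q(E) = 3`, and the UNRAMIFIED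
quadratic twist of a IV∕IV* fibre with `Φ(𝔽_q) = ℤ/3` has `3 ∤ c`). CONCLUSION:
`ord_p ∏c(E) + ord_p ∏c(E^{d_K}) ≤ Σ_{ℓ∈S} ord_p(ord_ℓ Δ_min(E)) + Σ_{q∈C} b q + 2·ord_p c_{q₁}(E)`. Places in `S ∩ C` are charged on the `S`
side only (the bound is monotone). Nothing about `q₁` beyond «bad, outside `S ∪ C`, split in `K`» and nothing about `C` beyond `hC` is used.
[cite: JetchevSkinnerWan2017, §7.4.2 (p. 31) and §7.3.1 (eq:tamK)] [cite: SilvermanAEC2009, VII.6 Ex. 7.6]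
[cite: SilvermanATAEC1994, IV.9.4 Steps 2, 5, 6, 8 and Cor. IV.9.2(d)] [cite: KohenPacetti2016, Thm. 3.6 (the Cartan places; shape only)] -/
theorem padicValNat_tamagawaProduct_add_twist_le_of_inertSet'_binder_of_extraPlace_of_budgetSet
    (W : WeierstrassCurve ℚ) [W.IsElliptic] [W.IsGloballyMinimal] (p : ℕ) [Fact p.Prime]
    (hp2 : p ≠ 2) (K : Type) [Field K] [NumberField K] (h2 : Module.finrank ℚ K = 2)
    (h5 : ∀ (q : ℕ) [Fact q.Prime], (q : ℤ) ∣ NumberField.discr K → W.HasGoodReductionAtPrime q →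
      q ≠ 2 → 5 ≤ q ∨ 5 ≤ p)
    -- the saved place: a bad prime outside `S ∪ C`
    (q₁ : ℕ) [Fact q₁.Prime] (hbad₁ : ¬ W.HasGoodReductionAtPrime q₁)
    -- the budgeted extra set and its budget
    (C : Finset ℕ) (b : ℕ → ℕ) (hq₁C : q₁ ∉ C)
    (hshape : ∀ (q : ℕ) [Fact q.Prime], q ≠ q₁ → q ∉ C → p ∣ (W.baseChange ℚ_[q]).localTamagawaNumber ℤ_[q] →
      W.HasSplitMultiplicativeReductionAtPrime q)
    {Wd : WeierstrassCurve ℚ} [Wd.IsElliptic] [Wd.IsGloballyMinimal] (Cd : VariableChange ℚ)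
    (hWd : Cd • W.quadraticTwist (NumberField.discr K : ℚ) = Wd)
    -- THE binder at `2`
    (hbind : (2 : ℤ) ∣ NumberField.discr K → W.HasGoodReductionAtPrime 2 →
      ¬ p ∣ (Wd.baseChange ℚ_[2]).localTamagawaNumber ℤ_[2])
    (S : Finset ℕ) (hq₁S : q₁ ∉ S)
    (hS : ∀ ℓ ∈ S, ∃ _ : Fact ℓ.Prime, Mult W ℓ ∧
      ((ℓ ≠ 2 ∧ jacobiSym (NumberField.discr K) ℓ = -1) ∨ (ℓ = 2 ∧ NumberField.discr K % 8 = 5)))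
    (hsplit : ∀ (ℓ : ℕ) [Fact ℓ.Prime], ¬ W.HasGoodReductionAtPrime ℓ → ℓ ∉ S → ℓ ∉ C →
      IsSquare (algebraMap ℚ ℚ_[ℓ] (NumberField.discr K : ℚ)))
    (hFC : ∀ (ℓ : ℕ) [Fact ℓ.Prime], ℓ ∉ S → ℓ ≠ q₁ → ℓ ∉ C → W.HasSplitMultiplicativeReductionAtPrime ℓ →
      ¬ p ∣ padicValInt ℓ W.minimalDiscriminantInt)
    (hC : ∀ (q : ℕ) [Fact q.Prime], q ∈ C →
      padicValNat p ((W.baseChange ℚ_[q]).localTamagawaNumber ℤ_[q]) +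
        padicValNat p ((Wd.baseChange ℚ_[q]).localTamagawaNumber ℤ_[q]) ≤ b q) :
    padicValNat p W.tamagawaProduct + padicValNat p Wd.tamagawaProduct ≤
      (∑ ℓ ∈ S, padicValNat p (padicValInt ℓ W.minimalDiscriminantInt)) + (∑ q ∈ C, b q) +
        2 * padicValNat p ((W.baseChange ℚ_[q₁]).localTamagawaNumber ℤ_[q₁]) := by
  have hp : p.Prime := Fact.out
  have hfW : (W.badPlaces ℤ).Finite := W.finite_badPlaces_holds ℤ
  have hfWd : (Wd.badPlaces ℤ).Finite := Wd.finite_badPlaces_holds ℤ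
  set s : Finset (HeightOneSpectrum ℤ) := hfW.toFinset ∪ hfWd.toFinset with hs
  have hsW : ∀ v, ¬ W.HasGoodReductionAt v → v ∈ s := fun v hv ↦
    Finset.mem_union_left _ (by rw [Set.Finite.mem_toFinset, mem_badPlaces_iff]; exact hv)
  have hsWd : ∀ v, ¬ Wd.HasGoodReductionAt v → v ∈ s := fun v hv ↦
    Finset.mem_union_right _ (by rw [Set.Finite.mem_toFinset, mem_badPlaces_iff]; exact hv)
  set f : HeightOneSpectrum ℤ → ℕ := fun v ↦
    haveI := Fact.mk (primesEquiv v).2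
    padicValNat p ((W.baseChange ℚ_[primesEquiv v]).localTamagawaNumber ℤ_[primesEquiv v]) +
      padicValNat p ((Wd.baseChange ℚ_[primesEquiv v]).localTamagawaNumber ℤ_[primesEquiv v]) with hf
  set g : ℕ → ℕ := fun ℓ ↦ padicValNat p (padicValInt ℓ W.minimalDiscriminantInt) with hg
  -- the bound at the saved place
  set b₁ : ℕ := 2 * padicValNat p ((W.baseChange ℚ_[q₁]).localTamagawaNumber ℤ_[q₁]) with hb₁
  -- the per-place majorant: `S`-places by `g`, then `C`-places by `b`, then `q₁` by `b₁`, else `0`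
  set m : ℕ → ℕ := fun ℓ ↦ if ℓ ∈ S then g ℓ else if ℓ ∈ C then b ℓ else if ℓ = q₁ then b₁ else 0 with hm
  have hterm : ∀ v : HeightOneSpectrum ℤ, f v ≤ m (primesEquiv v : ℕ) := by
    intro v
    haveI := Fact.mk (primesEquiv v).2
    have key : ∀ (q : ℕ) (hq : Fact q.Prime), (primesEquiv v : ℕ) = q →
        padicValNat p (@WeierstrassCurve.localTamagawaNumber ℤ_[q] _ _ _ ℚ_[q] _ _ _ (W.baseChange ℚ_[q])) +
          padicValNat p (@WeierstrassCurve.localTamagawaNumber ℤ_[q] _ _ _ ℚ_[q] _ _ _ (Wd.baseChange ℚ_[q])) ≤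
          m q := by
      rintro q hq hvq
      by_cases hqS : q ∈ S
      · obtain ⟨_, hmult, hcase⟩ := hS q hqS
        rw [hm]; dsimp only; rw [if_pos hqS, hg]
        rcases hcase with ⟨hq2, hJ⟩ | ⟨rfl, h8⟩
        · exact padicValNat_localTamagawaNumber_add_twist_le_of_inert_odd W K Cd hWd q hq2 hJ p hp2
            hmult
        · exact padicValNat_localTamagawaNumber_add_twist_le_of_inert_two_odd W K Cd hWd h8 p hp2
            hmult
      · rw [hm]; dsimp only; rw [if_neg hqS]
        by_cases hqC : q ∈ C
        · -- a budgeted place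
          rw [if_pos hqC]
          exact hC q hqC
        · rw [if_neg hqC]
          by_cases hq1 : q = q₁
          · -- the saved place: `c_{q₁}(E^{d_K}) = c_{q₁}(E)` (split in `K`)
            subst hq1
            rw [if_pos rfl, hb₁]
            haveI : (W.baseChange ℚ_[q]).IsElliptic := inferInstanceAs (W.map (algebraMap ℚ ℚ_[q])).IsElliptic
            rw [localTamagawaNumber_twist_eq_of_isSquare W K Cd hWd q (hsplit q hbad₁ hqS hqC), two_mul]
          · rw [if_neg hq1, Nat.le_zero]
            by_cases hgood : W.HasGoodReductionAtPrime q
            · refine padicValNat_localTamagawaNumber_add_twist_eq_zero_of_good_binder W K Cd hWd q p hp2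
                h2 (fun hqd hq2 ↦ h5 q hqd hgood hq2) ?_ hgood
              rintro hqd rfl
              exact hbind hqd hgood
            · exact padicValNat_localTamagawaNumber_add_twist_eq_zero_of_isSquare_of_shape W K Cd hWd q p
                (hsplit q hgood hqS hqC) (hshape q hq1 hqC) (hFC q hqS hq1 hqC)
    exact key _ _ rfl
  -- the majorant against the three buckets
  have hm_le : ∀ ℓ : ℕ, m ℓ ≤ (if ℓ ∈ S then g ℓ else 0) + (if ℓ ∈ C then b ℓ else 0) +
      (if ℓ = q₁ then b₁ else 0) := by
    intro ℓ
    rw [hm]; dsimp only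
    by_cases hℓS : ℓ ∈ S
    · rw [if_pos hℓS, if_pos hℓS]; omega
    · rw [if_neg hℓS, if_neg hℓS]
      by_cases hℓC : ℓ ∈ C
      · rw [if_pos hℓC, if_pos hℓC]; omega
      · rw [if_neg hℓC, if_neg hℓC]; omega
  rw [tamagawaProduct_eq_prod W s hsW, tamagawaProduct_eq_prod Wd s hsWd,
    padicValNat_finset_prod_extraSet p s _ fun v _ ↦ ?_,
    padicValNat_finset_prod_extraSet p s _ fun v _ ↦ ?_, ← Finset.sum_add_distrib]
  · calc ∑ v ∈ s, f v
        ≤ ∑ v ∈ s, m (primesEquiv v : ℕ) := Finset.sum_le_sum fun v _ ↦ hterm v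
      _ = ∑ ℓ ∈ s.image (fun v ↦ (primesEquiv v : ℕ)), m ℓ := by
          rw [Finset.sum_image]
          intro v _ w _ h
          exact primesEquiv.injective (Subtype.ext h)
      _ ≤ ∑ ℓ ∈ s.image (fun v ↦ (primesEquiv v : ℕ)),
            ((if ℓ ∈ S then g ℓ else 0) + (if ℓ ∈ C then b ℓ else 0) + (if ℓ = q₁ then b₁ else 0)) :=
          Finset.sum_le_sum fun ℓ _ ↦ hm_le ℓ
      _ = (∑ ℓ ∈ s.image (fun v ↦ (primesEquiv v : ℕ)), (if ℓ ∈ S then g ℓ else 0)) +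
            (∑ ℓ ∈ s.image (fun v ↦ (primesEquiv v : ℕ)), (if ℓ ∈ C then b ℓ else 0)) +
            ∑ ℓ ∈ s.image (fun v ↦ (primesEquiv v : ℕ)), (if ℓ = q₁ then b₁ else 0) := by
          rw [Finset.sum_add_distrib, Finset.sum_add_distrib]
      _ ≤ (∑ ℓ ∈ S, g ℓ) + (∑ q ∈ C, b q) + b₁ := by
          refine Nat.add_le_add (Nat.add_le_add ?_ ?_) ?_
          · rw [← Finset.sum_filter]
            exact Finset.sum_le_sum_of_subset_of_nonneg (fun ℓ hℓ ↦ (Finset.mem_filter.mp hℓ).2)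
              fun _ _ _ ↦ Nat.zero_le _
          · rw [← Finset.sum_filter]
            exact Finset.sum_le_sum_of_subset_of_nonneg (fun ℓ hℓ ↦ (Finset.mem_filter.mp hℓ).2)
              fun _ _ _ ↦ Nat.zero_le _
          · rw [Finset.sum_ite_eq']
            split_ifs
            · exact le_rfl
            · exact Nat.zero_le _
  · haveI := Fact.mk (primesEquiv v).2
    haveI : (W.baseChange ℚ_[primesEquiv v]).IsElliptic :=
      inferInstanceAs (W.map (algebraMap ℚ ℚ_[primesEquiv v])).IsElliptic
    exact localTamagawaNumber_padic_ne_zero_holds (primesEquiv v) _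
  · haveI := Fact.mk (primesEquiv v).2
    haveI : (Wd.baseChange ℚ_[primesEquiv v]).IsElliptic :=
      inferInstanceAs (Wd.map (algebraMap ℚ ℚ_[primesEquiv v])).IsElliptic
    exact localTamagawaNumber_padic_ne_zero_holds (primesEquiv v) _


/-! ### §2 (appended, tam3-p1 g19). The same bookkeeping WITHOUT a saved place: a budgeted extra set only -/

/-- **The numeric Tamagawa condition of JSW §7.4.2 at every ODD `p`, ANY `d_K`, modulo the binder at `2`, with a BUDGETED EXTRA SET `C` of bad
primes and NO saved place.** x11b3's `padicValNat_tamagawaProduct_add_twist_le_of_inertSet'_binder` (`S` a set of multiplicative primes inert in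
`K`, every other bad prime split) except that a finite set `C` of primes is exempted from the Tamagawa SHAPE, the très-ramifié and the
`K`-SPLITTING binders, each `q ∈ C` charged an abstract budget `b q ≥ ord_p c_q(E) + ord_p c_q(Wd)` (bsd-idea-10's CARTAN places: `b = 1`).
CONCLUSION: `ord_p ∏c(E) + ord_p ∏c(E^{d_K}) ≤ Σ_{ℓ∈S} ord_p(ord_ℓ Δ_min(E)) + Σ_{q∈C} b q` — the `hT` input of `missingUpperBoundAt_of_shimuraShapes(_of_saving)`
with `T := Σ_S + Σ_C b` for configuration (A0) («inert-servable off `C`», no exempted place) of an extra road. With `C = ∅` it is x11b3's theorem.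
[cite: JetchevSkinnerWan2017, §7.4.2 (p. 31) and §7.3.1 (eq:tamK)] [cite: SilvermanATAEC1994, IV.9.4 Steps 2, 5, 6, 8 and Cor. IV.9.2(d)]
[cite: KohenPacetti2016, Thm. 3.6 (the Cartan places; shape only)] -/
theorem padicValNat_tamagawaProduct_add_twist_le_of_inertSet'_binder_of_budgetSet
    (W : WeierstrassCurve ℚ) [W.IsElliptic] [W.IsGloballyMinimal] (p : ℕ) [Fact p.Prime]
    (hp2 : p ≠ 2) (K : Type) [Field K] [NumberField K] (h2 : Module.finrank ℚ K = 2)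
    (h5 : ∀ (q : ℕ) [Fact q.Prime], (q : ℤ) ∣ NumberField.discr K → W.HasGoodReductionAtPrime q →
      q ≠ 2 → 5 ≤ q ∨ 5 ≤ p)
    -- the budgeted extra set and its budget
    (C : Finset ℕ) (b : ℕ → ℕ)
    (hshape : ∀ (q : ℕ) [Fact q.Prime], q ∉ C → p ∣ (W.baseChange ℚ_[q]).localTamagawaNumber ℤ_[q] →
      W.HasSplitMultiplicativeReductionAtPrime q)
    {Wd : WeierstrassCurve ℚ} [Wd.IsElliptic] [Wd.IsGloballyMinimal] (Cd : VariableChange ℚ)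
    (hWd : Cd • W.quadraticTwist (NumberField.discr K : ℚ) = Wd)
    -- THE binder at `2`
    (hbind : (2 : ℤ) ∣ NumberField.discr K → W.HasGoodReductionAtPrime 2 →
      ¬ p ∣ (Wd.baseChange ℚ_[2]).localTamagawaNumber ℤ_[2])
    (S : Finset ℕ)
    (hS : ∀ ℓ ∈ S, ∃ _ : Fact ℓ.Prime, Mult W ℓ ∧
      ((ℓ ≠ 2 ∧ jacobiSym (NumberField.discr K) ℓ = -1) ∨ (ℓ = 2 ∧ NumberField.discr K % 8 = 5)))
    (hsplit : ∀ (ℓ : ℕ) [Fact ℓ.Prime], ¬ W.HasGoodReductionAtPrime ℓ → ℓ ∉ S → ℓ ∉ C →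
      IsSquare (algebraMap ℚ ℚ_[ℓ] (NumberField.discr K : ℚ)))
    (hFC : ∀ (ℓ : ℕ) [Fact ℓ.Prime], ℓ ∉ S → ℓ ∉ C → W.HasSplitMultiplicativeReductionAtPrime ℓ →
      ¬ p ∣ padicValInt ℓ W.minimalDiscriminantInt)
    (hC : ∀ (q : ℕ) [Fact q.Prime], q ∈ C →
      padicValNat p ((W.baseChange ℚ_[q]).localTamagawaNumber ℤ_[q]) +
        padicValNat p ((Wd.baseChange ℚ_[q]).localTamagawaNumber ℤ_[q]) ≤ b q) :
    padicValNat p W.tamagawaProduct + padicValNat p Wd.tamagawaProduct ≤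
      (∑ ℓ ∈ S, padicValNat p (padicValInt ℓ W.minimalDiscriminantInt)) + ∑ q ∈ C, b q := by
  have hp : p.Prime := Fact.out
  have hfW : (W.badPlaces ℤ).Finite := W.finite_badPlaces_holds ℤ
  have hfWd : (Wd.badPlaces ℤ).Finite := Wd.finite_badPlaces_holds ℤ
  set s : Finset (HeightOneSpectrum ℤ) := hfW.toFinset ∪ hfWd.toFinset with hs
  have hsW : ∀ v, ¬ W.HasGoodReductionAt v → v ∈ s := fun v hv ↦
    Finset.mem_union_left _ (by rw [Set.Finite.mem_toFinset, mem_badPlaces_iff]; exact hv)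
  have hsWd : ∀ v, ¬ Wd.HasGoodReductionAt v → v ∈ s := fun v hv ↦
    Finset.mem_union_right _ (by rw [Set.Finite.mem_toFinset, mem_badPlaces_iff]; exact hv)
  set f : HeightOneSpectrum ℤ → ℕ := fun v ↦
    haveI := Fact.mk (primesEquiv v).2
    padicValNat p ((W.baseChange ℚ_[primesEquiv v]).localTamagawaNumber ℤ_[primesEquiv v]) +
      padicValNat p ((Wd.baseChange ℚ_[primesEquiv v]).localTamagawaNumber ℤ_[primesEquiv v]) with hf
  set g : ℕ → ℕ := fun ℓ ↦ padicValNat p (padicValInt ℓ W.minimalDiscriminantInt) with hg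
  -- the per-place majorant: `S`-places by `g`, then `C`-places by `b`, else `0`
  set m : ℕ → ℕ := fun ℓ ↦ if ℓ ∈ S then g ℓ else if ℓ ∈ C then b ℓ else 0 with hm
  have hterm : ∀ v : HeightOneSpectrum ℤ, f v ≤ m (primesEquiv v : ℕ) := by
    intro v
    haveI := Fact.mk (primesEquiv v).2
    have key : ∀ (q : ℕ) (hq : Fact q.Prime), (primesEquiv v : ℕ) = q →
        padicValNat p (@WeierstrassCurve.localTamagawaNumber ℤ_[q] _ _ _ ℚ_[q] _ _ _ (W.baseChange ℚ_[q])) +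
          padicValNat p (@WeierstrassCurve.localTamagawaNumber ℤ_[q] _ _ _ ℚ_[q] _ _ _ (Wd.baseChange ℚ_[q])) ≤
          m q := by
      rintro q hq hvq
      by_cases hqS : q ∈ S
      · obtain ⟨_, hmult, hcase⟩ := hS q hqS
        rw [hm]; dsimp only; rw [if_pos hqS, hg]
        rcases hcase with ⟨hq2, hJ⟩ | ⟨rfl, h8⟩
        · exact padicValNat_localTamagawaNumber_add_twist_le_of_inert_odd W K Cd hWd q hq2 hJ p hp2
            hmult
        · exact padicValNat_localTamagawaNumber_add_twist_le_of_inert_two_odd W K Cd hWd h8 p hp2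
            hmult
      · rw [hm]; dsimp only; rw [if_neg hqS]
        by_cases hqC : q ∈ C
        · rw [if_pos hqC]
          exact hC q hqC
        · rw [if_neg hqC, Nat.le_zero]
          by_cases hgood : W.HasGoodReductionAtPrime q
          · refine padicValNat_localTamagawaNumber_add_twist_eq_zero_of_good_binder W K Cd hWd q p hp2
              h2 (fun hqd hq2 ↦ h5 q hqd hgood hq2) ?_ hgood
            rintro hqd rfl
            exact hbind hqd hgood
          · exact padicValNat_localTamagawaNumber_add_twist_eq_zero_of_isSquare_of_shape W K Cd hWd q p
              (hsplit q hgood hqS hqC) (hshape q hqC) (hFC q hqS hqC)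
    exact key _ _ rfl
  have hm_le : ∀ ℓ : ℕ, m ℓ ≤ (if ℓ ∈ S then g ℓ else 0) + (if ℓ ∈ C then b ℓ else 0) := by
    intro ℓ
    rw [hm]; dsimp only
    split_ifs <;> omega
  rw [tamagawaProduct_eq_prod W s hsW, tamagawaProduct_eq_prod Wd s hsWd,
    padicValNat_finset_prod_extraSet p s _ fun v _ ↦ ?_,
    padicValNat_finset_prod_extraSet p s _ fun v _ ↦ ?_, ← Finset.sum_add_distrib]
  · calc ∑ v ∈ s, f v
        ≤ ∑ v ∈ s, m (primesEquiv v : ℕ) := Finset.sum_le_sum fun v _ ↦ hterm v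
      _ = ∑ ℓ ∈ s.image (fun v ↦ (primesEquiv v : ℕ)), m ℓ := by
          rw [Finset.sum_image]
          intro v _ w _ h
          exact primesEquiv.injective (Subtype.ext h)
      _ ≤ ∑ ℓ ∈ s.image (fun v ↦ (primesEquiv v : ℕ)),
            ((if ℓ ∈ S then g ℓ else 0) + (if ℓ ∈ C then b ℓ else 0)) :=
          Finset.sum_le_sum fun ℓ _ ↦ hm_le ℓ
      _ = (∑ ℓ ∈ s.image (fun v ↦ (primesEquiv v : ℕ)), (if ℓ ∈ S then g ℓ else 0)) +
            ∑ ℓ ∈ s.image (fun v ↦ (primesEquiv v : ℕ)), (if ℓ ∈ C then b ℓ else 0) :=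
          Finset.sum_add_distrib
      _ ≤ (∑ ℓ ∈ S, g ℓ) + ∑ q ∈ C, b q := by
          refine Nat.add_le_add ?_ ?_
          · rw [← Finset.sum_filter]
            exact Finset.sum_le_sum_of_subset_of_nonneg (fun ℓ hℓ ↦ (Finset.mem_filter.mp hℓ).2)
              fun _ _ _ ↦ Nat.zero_le _
          · rw [← Finset.sum_filter]
            exact Finset.sum_le_sum_of_subset_of_nonneg (fun ℓ hℓ ↦ (Finset.mem_filter.mp hℓ).2)
              fun _ _ _ ↦ Nat.zero_le _
  · haveI := Fact.mk (primesEquiv v).2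
    haveI : (W.baseChange ℚ_[primesEquiv v]).IsElliptic :=
      inferInstanceAs (W.map (algebraMap ℚ ℚ_[primesEquiv v])).IsElliptic
    exact localTamagawaNumber_padic_ne_zero_holds (primesEquiv v) _
  · haveI := Fact.mk (primesEquiv v).2
    haveI : (Wd.baseChange ℚ_[primesEquiv v]).IsElliptic :=
      inferInstanceAs (Wd.map (algebraMap ℚ ℚ_[primesEquiv v])).IsElliptic
    exact localTamagawaNumber_padic_ne_zero_holds (primesEquiv v) _

end Summit.BirchSwinnertonDyer.BirchSwinnertonDyer.Theorems

end
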